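import Summits.QuantumFields.YangMills.Theorems.BalabanLadderInfVolRPSeries
import Summits.QuantumFields.YangMills.Theorems.BalabanLadderInfVolTranslations
import HarnessLib

/-!
# Infinite volume by compactness, class-parametric form III: E2 (reflection positivity) of the «`L → ∞` first»
# continuum data along ANY torus limit states (odd or even sides)

HONEST FRAMING (cell `ym-fleet`, seat `ym-infvol-p2`, director-ym R136 (i); count-neutral helper for the route owner's
ruling on the «torus parity» junction (ym-beyond-p2 g20 2026-08-26T18:17:23Z, (c′)∕(E)); companion of
`InfiniteVolumeMomentBoundsOnSides` and `InfiniteVolumeContinuumDataOn`).  Pure soft analysis, kernel-checked.  Lattice reflection positivity of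
EVERY torus limit state (odd or even side) is the tree's GaugeBoot theorem `siteRP_zero_of_mem_infiniteVolumeLimitPoints`.
NOTHING is asserted about Bałaban's renormalisation group, rotations (E1), non-triviality (NT∕NG), a mass gap, or Clay.

WHAT IS PROVED ([folklore] throughout).
* §1 (namespace `InfVolRP`, seat p3's toolkit) — the parity-free twins of p3's series-form E2 theorems, i.e. with
  `μ ∈ oddTorusLimitPoints r β` replaced by `μ ∈ infiniteVolumeLimitPoints r.ρ β` (p3's proofs pass through this set
  anyway): `stateMomentStr_series_osForm_nonneg_limitStates`, `rpPos_of_stateMomentStr_series_tendsto_limitStates`,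
  **`rpPos_of_limitStates_series`**, **`rpPos_of_limitStates_centre`** (`RPPos S₁ ∧ IsReflectionPositive`; evaluation points
  written as in the route's DATA clause, cf. `InfiniteVolumeContinuum.centre_point_eq`).
* The class package with E2 and hermiticity (`exists_ivDataOn_onSides_rp`, consuming `exists_ivDataOn_onSides` of
  `InfiniteVolumeContinuumDataOn`) is filed separately (`InfiniteVolumeContinuumDataOnRP.lean`).

References: K. Osterwalder, E. Seiler, Ann. Phys. 110 (1978) §2; J. Glimm, A. Jaffe, Quantum Physics (1987) §6.1;
K. Osterwalder, R. Schrader, CMP 31 (1973), CMP 42 (1975); S. Chatterjee, arXiv:1803.01950 §2.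
-/

set_option autoImplicit false

noncomputable section

open scoped SchwartzMap BigOperators
open MeasureTheory Filter Topology
open Literature.MathematicalPhysics.QuantumFieldTheory hiding ZdEdge
open Literature.MathematicalPhysics.QuantumLattice
open Literature.MathematicalPhysics.AQFT
open Literature.Probability.LatticeModels (box Site)
open Summit.QuantumFields.GaugeBoot (siteRP_zero_of_mem_infiniteVolumeLimitPoints)
open Summit.QuantumFields.YangMills.Cruxes.OSLegsFromFemtoAndGap.DlrCollarTransfer
  (plane RPPos isReflectionPositive_of_rpPos)

/-! ## §1 E2 of the continuum limit along ANY torus limit states (parity-free twins of p3's series theorems) -/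

namespace Summit.QuantumFields.YangMills.Theorems.InfVolRP

open Summit.QuantumFields.YangMills.Theorems.InfiniteVolume (stateMomentStr)

variable {G : Type} [Group G] [TopologicalSpace G] [IsTopologicalGroup G] [CompactSpace G]
  [MeasurableSpace G] [BorelSpace G]

/-- **Exact E2 of the plane-string series of ANY torus limit state** (`μ ∈ infiniteVolumeLimitPoints r.ρ β`, `β ≥ 0`,
odd or even sides): the parity-free twin of `stateMomentStr_series_osForm_nonneg`. [folklore] -/
theorem stateMomentStr_series_osForm_nonneg_limitStates [T2Space G] [SecondCountableTopology G] (r : LatticeRep G)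
    {β : ℝ} (hβ : 0 ≤ β) {μ : Measure (LGConfig 4 G)} (hμ : μ ∈ infiniteVolumeLimitPoints (d := 4) r.ρ β)
    {a : ℝ} (ha : 0 < a) (ha4 : a ≤ 1 / 4) {o : Fin 4 × Fin 4 → EuclideanSpace ℝ (Fin 4)} (hos : ∀ q, ‖o q‖ ≤ 1)
    (ho : ∀ q, 0 ≤ o q 0 ∧ o q 0 < 1) (hoc : ∀ q : Fin 4 × Fin 4, q.1 < q.2 → 2 * o q 0 = if q.1 = 0 then 1 else 0)
    {T : ℝ} {N : ℕ} {deg : Fin N → ℕ} (F : (j : Fin N) → 𝓢((Fin (deg j) → EuclideanSpace ℝ (Fin 4)), ℂ))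
    (hF : ∀ j (u : Fin (deg j) → EuclideanSpace ℝ (Fin 4)), (∃ l, u l 0 ≤ 0 ∨ T < u l 0) → F j u = 0)
    (H : (i j : Fin N) → 𝓢((Fin (deg i + deg j) → EuclideanSpace ℝ (Fin 4)), ℂ))
    (hH : ∀ i j, IsAppendTensorOf (H i j) (osAdjoint (F i)) (F j)) :
    let z := ∑ i, ∑ j,
      ∑ Q ∈ Fintype.piFinset (fun _ : Fin (deg i + deg j) => Finset.univ.filter fun pl : Fin 4 × Fin 4 => pl.1 < pl.2),
        ∑' w : Fin (deg i + deg j) → Site 4,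
          ((stateMomentStr G r μ (deg i + deg j) Q w : ℝ) : ℂ) * H i j (fun l => a • (siteToE (w l) + o (Q l)))
    0 ≤ z.re ∧ z.im = 0 := by
  obtain ⟨L, -, hprob, -⟩ := id hμ
  have hTI : IsZdTranslationInvariant μ :=
    Summit.QuantumFields.YangMills.Theorems.InfiniteVolume.isZdTranslationInvariant_of_mem_infiniteVolumeLimitPoints r hμ
  simp_rw [stateMomentStr_eq_strWeight r hTI]
  exact series_osForm_nonneg r (siteRP_zero_of_mem_infiniteVolumeLimitPoints r.ρ r.continuous hβ hμ) ha ha4 hos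
    ho hoc (fun q => ∫ V, plane G r q 0 V ∂μ) F hF H hH

/-- **E2 of the continuum limit along ANY torus limit states, direct form** (parity-free twin of
`rpPos_of_stateMomentStr_series_tendsto`). [folklore] -/
theorem rpPos_of_stateMomentStr_series_tendsto_limitStates [T2Space G] [SecondCountableTopology G] (r : LatticeRep G)
    {β : ℕ → ℝ} (hβ : ∀ᶠ k in atTop, 0 ≤ β k) (μ : ℕ → Measure (LGConfig 4 G))
    (hμ : ∀ k, μ k ∈ infiniteVolumeLimitPoints (d := 4) r.ρ (β k)) {a : ℕ → ℝ} (ha : ∀ k, 0 < a k)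
    (ha0 : Tendsto a atTop (𝓝 0))
    {o : Fin 4 × Fin 4 → EuclideanSpace ℝ (Fin 4)} (hos : ∀ q, ‖o q‖ ≤ 1) (ho : ∀ q, 0 ≤ o q 0 ∧ o q 0 < 1)
    (hoc : ∀ q : Fin 4 × Fin 4, q.1 < q.2 → 2 * o q 0 = if q.1 = 0 then 1 else 0)
    (S₁ : SchwingerFamily (EuclideanSpace ℝ (Fin 4)))
    (hlim : ∀ (n : ℕ) (F : 𝓢((Fin n → EuclideanSpace ℝ (Fin 4)), ℂ)), IsOffDiagonal F →
      Tendsto (fun k =>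
        ∑ Q ∈ Fintype.piFinset (fun _ : Fin n => Finset.univ.filter fun pl : Fin 4 × Fin 4 => pl.1 < pl.2),
          ∑' x : Fin n → Site 4,
            ((stateMomentStr G r (μ k) n Q x : ℝ) : ℂ) * F (fun l => a k • (siteToE (x l) + o (Q l)))) atTop
        (𝓝 (S₁ n F))) :
    RPPos S₁ := by
  refine rpPos_of_eventually_nonneg S₁ _ hlim fun T N deg F _ _ hFT => ?_
  have h4 : ∀ᶠ k in atTop, a k ≤ 1 / 4 :=
    ((tendsto_order.1 ha0).2 (1 / 4) (by norm_num)).mono fun k hk => hk.le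
  filter_upwards [h4, hβ] with k hk hβk
  exact stateMomentStr_series_osForm_nonneg_limitStates r hβk (hμ k) (ha k) hk hos ho hoc F hFT
    (fun i j => (osAdjoint (F i)).appendTensor (F j)) (fun i j => isAppendTensorOf_appendTensor _ _)

/-- **E2 of the continuum limit along ANY torus limit states, p2's currency** (parity-free twin of
`rpPos_of_oddTorusLimitStates_series`): `β k ≥ 0` eventually, `μ k ∈ infiniteVolumeLimitPoints r.ρ (β k)`, `a k > 0`,
`a k → 0`, centre-type offsets, plane-string limits `S n q` of the series on `⁰𝒮ₙ` (`n ≥ 2`, valid `q`), and a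
one-field family with `S₁ n = Σ_{q valid} S n q`, `S₁ 0 F = F()`, `S₁ 1 = 0`: then `RPPos S₁`. [folklore] -/
theorem rpPos_of_limitStates_series [T2Space G] [SecondCountableTopology G] (r : LatticeRep G)
    {β : ℕ → ℝ} (hβ : ∀ᶠ k in atTop, 0 ≤ β k) (μ : ℕ → Measure (LGConfig 4 G))
    (hμ : ∀ k, μ k ∈ infiniteVolumeLimitPoints (d := 4) r.ρ (β k)) {a : ℕ → ℝ} (ha : ∀ k, 0 < a k)
    (ha0 : Tendsto a atTop (𝓝 0))
    {o : Fin 4 × Fin 4 → EuclideanSpace ℝ (Fin 4)} (hos : ∀ q, ‖o q‖ ≤ 1) (ho : ∀ q, 0 ≤ o q 0 ∧ o q 0 < 1)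
    (hoc : ∀ q : Fin 4 × Fin 4, q.1 < q.2 → 2 * o q 0 = if q.1 = 0 then 1 else 0)
    (S : (n : ℕ) → (Fin n → Fin 4 × Fin 4) → (𝓢((Fin n → EuclideanSpace ℝ (Fin 4)), ℂ) →L[ℂ] ℂ))
    (hS : ∀ n : ℕ, 2 ≤ n → ∀ q : Fin n → Fin 4 × Fin 4, (∀ i, (q i).1 < (q i).2) →
      ∀ F : 𝓢((Fin n → EuclideanSpace ℝ (Fin 4)), ℂ), IsOffDiagonal F →
        Tendsto (fun k => ∑' x : Fin n → Site 4,
          ((stateMomentStr G r (μ k) n q x : ℝ) : ℂ) * F (fun l => a k • (siteToE (x l) + o (q l)))) atTop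
          (𝓝 (S n q F)))
    (S₁ : SchwingerFamily (EuclideanSpace ℝ (Fin 4)))
    (hS₁ : ∀ n : ℕ, 2 ≤ n → ∀ F : 𝓢((Fin n → EuclideanSpace ℝ (Fin 4)), ℂ),
      S₁ n F = ∑ q ∈ Fintype.piFinset (fun _ : Fin n => Finset.univ.filter fun pl : Fin 4 × Fin 4 => pl.1 < pl.2),
        S n q F)
    (hS₁0 : ∀ F : 𝓢((Fin 0 → EuclideanSpace ℝ (Fin 4)), ℂ), S₁ 0 F = F default)
    (hS₁1 : ∀ F : 𝓢((Fin 1 → EuclideanSpace ℝ (Fin 4)), ℂ), S₁ 1 F = 0) :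
    RPPos S₁ := by
  classical
  haveI hprob : ∀ k, IsProbabilityMeasure (μ k) := fun k => by
    obtain ⟨L, -, hprob, -⟩ := hμ k
    exact hprob
  refine rpPos_of_stateMomentStr_series_tendsto_limitStates r hβ μ hμ ha ha0 hos ho hoc S₁ fun n F hF => ?_
  rcases Nat.lt_or_ge n 2 with hn | hn
  · interval_cases n
    · -- arity 0: the empty string, weight 1, one point
      have hval : ∀ k, (∑ Q ∈ Fintype.piFinset (fun _ : Fin 0 => Finset.univ.filter fun pl : Fin 4 × Fin 4 => pl.1 < pl.2),
          ∑' x : Fin 0 → Site 4, ((stateMomentStr G r (μ k) 0 Q x : ℝ) : ℂ) *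
            F (fun l => a k • (siteToE (x l) + o (Q l)))) = S₁ 0 F := by
        intro k
        rw [hS₁0]
        have hpt : ∀ (Q : Fin 0 → Fin 4 × Fin 4) (x : Fin 0 → Site 4),
            F (fun l => a k • (siteToE (x l) + o (Q l))) = F default := fun Q x =>
          congrArg F (Subsingleton.elim _ _)
        simp_rw [stateMomentStr_zero, hpt, Complex.ofReal_one, one_mul]
        rw [tsum_const, Nat.card_unique, one_smul, Finset.sum_const, Finset.card_eq_one.2 ⟨default, ?_⟩, one_smul]
        ext Q
        simp only [Fintype.mem_piFinset, Finset.mem_singleton, IsEmpty.forall_iff, true_iff]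
        exact Subsingleton.elim _ _
      simp_rw [hval]
      exact tendsto_const_nhds
    · -- arity 1: the centred one-point weights vanish
      simp_rw [stateMomentStr_one, Complex.ofReal_zero, zero_mul, tsum_zero, Finset.sum_const_zero, hS₁1]
      exact tendsto_const_nhds
  · rw [hS₁ n hn F]
    refine tendsto_finsetSum _ fun Q hQ => hS n hn Q (fun i => ?_) F hF
    exact (Finset.mem_filter.1 ((Fintype.mem_piFinset.1 hQ) i)).2

/-- **E2 (`RPPos` and `IsReflectionPositive`) of the continuum limit along ANY torus limit states, plaquette-CENTRE
smearing written as in the route's DATA clause** (`a·x + (a/2)(e_{q.1}+e_{q.2})`): parity-free twin of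
`rpPos_of_oddTorusLimitStates_centre`. [folklore] -/
theorem rpPos_of_limitStates_centre [T2Space G] [SecondCountableTopology G] (r : LatticeRep G)
    {β : ℕ → ℝ} (hβ : ∀ᶠ k in atTop, 0 ≤ β k) (μ : ℕ → Measure (LGConfig 4 G))
    (hμ : ∀ k, μ k ∈ infiniteVolumeLimitPoints (d := 4) r.ρ (β k)) {a : ℕ → ℝ} (ha : ∀ k, 0 < a k)
    (ha0 : Tendsto a atTop (𝓝 0))
    (S : (n : ℕ) → (Fin n → Fin 4 × Fin 4) → (𝓢((Fin n → EuclideanSpace ℝ (Fin 4)), ℂ) →L[ℂ] ℂ))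
    (hS : ∀ n : ℕ, 2 ≤ n → ∀ q : Fin n → Fin 4 × Fin 4, (∀ i, (q i).1 < (q i).2) →
      ∀ F : 𝓢((Fin n → EuclideanSpace ℝ (Fin 4)), ℂ), IsOffDiagonal F →
        Tendsto (fun k => ∑' x : Fin n → Site 4, ((stateMomentStr G r (μ k) n q x : ℝ) : ℂ) *
          F (fun l => a k • siteToE (x l) +
            (a k / 2) • (EuclideanSpace.single (q l).1 (1 : ℝ) + EuclideanSpace.single (q l).2 (1 : ℝ))))
          atTop (𝓝 (S n q F)))
    (S₁ : SchwingerFamily (EuclideanSpace ℝ (Fin 4)))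
    (hS₁ : ∀ n : ℕ, 2 ≤ n → ∀ F : 𝓢((Fin n → EuclideanSpace ℝ (Fin 4)), ℂ),
      S₁ n F = ∑ q ∈ Fintype.piFinset (fun _ : Fin n => Finset.univ.filter fun pl : Fin 4 × Fin 4 => pl.1 < pl.2),
        S n q F)
    (hS₁0 : ∀ F : 𝓢((Fin 0 → EuclideanSpace ℝ (Fin 4)), ℂ), S₁ 0 F = F default)
    (hS₁1 : ∀ F : 𝓢((Fin 1 → EuclideanSpace ℝ (Fin 4)), ℂ), S₁ 1 F = 0) :
    RPPos S₁ ∧ S₁.toLabelled.IsReflectionPositive := by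
  have h : RPPos S₁ := by
    refine rpPos_of_limitStates_series r hβ μ hμ ha ha0 norm_centreOffset_le_one centreOffset_time
      (fun _ hq => two_mul_centreOffset_zero hq) S (fun n hn q hq F hF => ?_) S₁ hS₁ hS₁0 hS₁1
    have hpt : ∀ (k : ℕ) (x : Fin n → Site 4),
        (fun l => a k • (siteToE (x l) + centreOffset (q l))) =
          fun l => a k • siteToE (x l) +
            (a k / 2) • (EuclideanSpace.single (q l).1 (1 : ℝ) + EuclideanSpace.single (q l).2 (1 : ℝ)) :=
      fun k x => funext fun l => by
        unfold centreOffset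
        rw [if_pos (hq l), smul_add, smul_smul, mul_one_div]
    simp_rw [hpt]
    exact hS n hn q hq F hF
  exact ⟨h, isReflectionPositive_of_rpPos h⟩

end Summit.QuantumFields.YangMills.Theorems.InfVolRP

end
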